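import Summits.ResolutionOfSingularities.ResolutionOfSingularities.Theorems.FrobeniusClosingPatchingRelPerfectDepthPhaseCEndNearTransport
import Summits.ResolutionOfSingularities.ResolutionOfSingularities.Theorems.FrobeniusClosingPatchingRelPerfectCentreSeqExtendOpen
import Literature.AlgebraicGeometry.Resolution.BlowupsIntegral
import Literature.AlgebraicGeometry.Resolution.BlowupDisjointCentreWeights
import Literature.AlgebraicGeometry.Resolution.SigmaMaxEliminationInDim
import Literature.AlgebraicGeometry.Morphisms.IsoOverOpen
import HarnessLib

/-!
# Crux `PatchingRelPerfect` (stmt-ResolutionOfSingularities-16161), chain W5.2 — F7(β) (β-AX) X3 C-I (A′): THE PIECES BRIDGE —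
# local cures over DISJOINT CLOSED PIECES of the non-END locus glue to ONE blow-up sequence with local END everywhere

[OURS · L1 W5.2 · res-L1-w52-plan-1 RULING G12-49 (1) «FACE 1 RULED (β′) … NAMING: lead-1΄s bridge `goodEnd_of_closedPieces` → `…DepthPhaseCOnePieces`
— GO» (hand res-L1-w52-lead-1 g6).]  Replaces the role of NO printed item; NOT a statement of the manuscript under review (AI-written; AI review
weaker than expert review; counted 0).  Def-free.

THE MECHANISM (β′).  `K` on a regular Noetherian `X`; `𝓛₀` global letters; finitely many pairwise DISJOINT CLOSED pieces `P ⊆ cosupp K` off which `K`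
has local END (`IsEndNear K 𝓛₀`); for each piece a CURE: on every open immersion `g : Y ⟶ X` whose range contains `P` and misses the other pieces
(and a forbidden closed set), a blow-up sequence of `Y` with regular centres OVER `P`, regular top, and local END of the total transform at the
points over `P`.  Then ONE blow-up sequence of `X` with regular centres over `cosupp K` and regular top makes the total transform of `K`
locally END everywhere (`GoodEnd`).  Pieces are cured one after the other: the cure of `P` (on the open `X ∖ (other pieces)`) is extended to `X`
by `CentreSeqExtend.extend` — its centres lie over the closed `P`, so they are closed in `X` — and is an isomorphism off `P`
(`centreSeq_isIso_morphismRestrict_compl`), so the remaining pieces, their cures (composed with that open immersion) and the END off the pieces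
are transported verbatim (…DepthPhaseCEndNearTransport: PULL/PUSH along open immersions).

* §1 `centreSeq_isIso_morphismRestrict_compl` — a blow-up sequence with centres over a closed `Z` is an isomorphism over `X ∖ Z`; corollaries
  `centreSeq_isOpenImmersion_comp_of_range_subset` (an open immersion into the top missing the preimage of `Z` composes to an open immersion into `X`)
  and `centreSeq_exists_eq_comp_of_not_mem` (points off `Z` are hit).
* §2 `exists_isEndNear_extend` — END transfer through `CentreSeqExtend.extend` (recursion on the sequence, as `isLocallyPrincipal_comap_extend`).
* §3 **`goodEnd_of_closedPieces`** — the bridge (induction on the list of pieces, schemes generalised).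

## References
* U. Görtz, T. Wedhorn, *Algebraic Geometry I* (2nd ed. 2020), Prop. 13.91 (1)–(3). [GortzWedhorn2020]
* E. Bierstone, D. Grigoriev, P. Milman, J. Włodarczyk, arXiv:1206.3090, Def. 3.1.5 Remark (1), Thm. 8.0.5. [BierstoneGrigorievMilmanWlodarczyk2011]
-/

-- `Summit.<Summit>.<Sub>.Theorems` with `Sub = Summit` (single-conjunct summit, D-0017)
set_option linter.dupNamespace false

noncomputable section

namespace Summit.ResolutionOfSingularities.ResolutionOfSingularities.Theorems.X3LemmaM

open CategoryTheory AlgebraicGeometry TopologicalSpace IsLocalRing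
open Literature.AlgebraicGeometry.Resolution
open Scheme.IdealSheafData

universe u

/-! ## §1 A blow-up sequence is an isomorphism off its centres -/

/-- [OURS · L1 W5.2] **A blow-up sequence with centres over a closed `Z` is an isomorphism over `X ∖ Z`** (GW 13.91 (3), stage by stage).
[cite: GortzWedhorn2020, Prop. 13.91 (3)] -/
theorem centreSeq_isIso_morphismRestrict_compl : ∀ {X : Scheme.{u}} (c : CentreSeq X) {Z : Set X} (hZ : IsClosed Z),
    c.CentresOver Z → IsIso (c.comp ∣_ ⟨Zᶜ, hZ.isOpen_compl⟩)
  | X, .nil _, Z, hZ, _ => by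
    change IsIso (𝟙 X ∣_ _)
    infer_instance
  | X, .cons C rest, Z, hZ, hover => by
    obtain ⟨hC, hrest⟩ := hover
    change IsIso ((rest.comp ≫ blowup.π C) ∣_ _)
    haveI : IsIso (blowup.π C ∣_ ⟨Zᶜ, hZ.isOpen_compl⟩) :=
      (blowup.isBlowup C).isIso_morphismRestrict (Set.disjoint_compl_left_iff_subset.mpr hC)
    haveI : IsIso (rest.comp ∣_ blowup.π C ⁻¹ᵁ ⟨Zᶜ, hZ.isOpen_compl⟩) :=
      centreSeq_isIso_morphismRestrict_compl rest (hZ.preimage (blowup.π C).continuous) hrest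
    exact Literature.AlgebraicGeometry.Morphisms.isIso_morphismRestrict_comp _ _ _

/-- [OURS · L1 W5.2] **An open immersion into the top missing the preimage of `Z` composes with the sequence to an open immersion into `X`.**
[cite: GortzWedhorn2020, Prop. 13.91 (3)] -/
theorem centreSeq_isOpenImmersion_comp_of_range_subset {X Y : Scheme.{u}} (c : CentreSeq X) {Z : Set X} (hZ : IsClosed Z)
    (hover : c.CentresOver Z) (g : Y ⟶ c.top) [IsOpenImmersion g] (hg : Set.range (g ≫ c.comp).base ⊆ Zᶜ) :
    IsOpenImmersion (g ≫ c.comp) := by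
  set V : X.Opens := ⟨Zᶜ, hZ.isOpen_compl⟩
  haveI := centreSeq_isIso_morphismRestrict_compl c hZ hover
  haveI : IsOpenImmersion ((c.comp ⁻¹ᵁ V).ι ≫ c.comp) := by rw [← morphismRestrict_ι]; infer_instance
  have hrange : Set.range g.base ⊆ Set.range (c.comp ⁻¹ᵁ V).ι.base := by
    rintro _ ⟨y, rfl⟩
    rw [Scheme.Opens.range_ι]
    exact hg ⟨y, rfl⟩
  have hfac := IsOpenImmersion.lift_fac (c.comp ⁻¹ᵁ V).ι g hrange
  haveI : IsOpenImmersion (IsOpenImmersion.lift (c.comp ⁻¹ᵁ V).ι g hrange ≫ (c.comp ⁻¹ᵁ V).ι) := by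
    rw [hfac]; infer_instance
  haveI : IsOpenImmersion (IsOpenImmersion.lift (c.comp ⁻¹ᵁ V).ι g hrange) :=
    IsOpenImmersion.of_comp _ (c.comp ⁻¹ᵁ V).ι
  rw [← hfac, Category.assoc]
  infer_instance

/-- [OURS · L1 W5.2] **Points off `Z` are hit** by a blow-up sequence with centres over `Z`. [cite: GortzWedhorn2020, Prop. 13.91 (3)] -/
theorem centreSeq_exists_eq_comp_of_not_mem {X : Scheme.{u}} (c : CentreSeq X) {Z : Set X} (hZ : IsClosed Z) (hover : c.CentresOver Z)
    {x : X} (hx : x ∉ Z) : ∃ y : c.top, c.comp.base y = x := by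
  set V : X.Opens := ⟨Zᶜ, hZ.isOpen_compl⟩
  haveI := centreSeq_isIso_morphismRestrict_compl c hZ hover
  obtain ⟨y, hy⟩ := (ConcreteCategory.bijective_of_isIso (c.comp ∣_ V).base).2 ⟨x, hx⟩
  refine ⟨(c.comp ⁻¹ᵁ V).ι.base y, ?_⟩
  have := congrArg (fun p : (V : Scheme.{u}) => V.ι.base p) hy
  simp only at this
  rw [← Scheme.Hom.comp_apply, ← morphismRestrict_ι, Scheme.Hom.comp_apply, this, Scheme.Opens.ι_apply]

/-! ## §2 END transfer through `CentreSeqExtend.extend` -/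

/-- [OURS · L1 W5.2] **Local END transfers through the extension of a multiple blow-up from an open** (the END analogue of
`CentreSeqExtend.isLocallyPrincipal_comap_extend`): `s` a multiple blow-up of `U` (open in `X` via `j`) with centres over the closed `Z ⊆ j(U)`;
if `K` is locally END at its cosupport points off `Z ∪ R` and the total transform of `K|_U` under `s` is locally END at the points over `Z`,
then the total transform of `K` under `extend s j` is locally END at every point of its cosupport not over `R` (one letter list).
[cite: GortzWedhorn2020, Prop. 13.91 (1)–(3)] -/
theorem exists_isEndNear_extend : ∀ {X U : Scheme.{u}} (s : CentreSeq U) (j : U ⟶ X) [IsOpenImmersion j] [IsNoetherian X] [IsNoetherian U]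
    {Z R : Set X}, IsClosed Z → Z ⊆ Set.range j.base → s.CentresOver (j.base ⁻¹' Z) →
    ∀ (K : X.IdealSheafData) (𝓛 : List X.IdealSheafData) (𝓛' : List s.top.IdealSheafData),
    (∀ x ∈ (K.support : Set X), x ∉ Z → x ∉ R → IsEndNear K 𝓛 x) →
    (∀ y ∈ (((K.comap j).comap s.comp).support : Set s.top), j.base (s.comp.base y) ∈ Z →
      IsEndNear ((K.comap j).comap s.comp) 𝓛' y) →
    ∃ 𝓛'' : List (CentreSeqExtend.extend s j).top.IdealSheafData,
      ∀ y ∈ ((K.comap (CentreSeqExtend.extend s j).comp).support : Set (CentreSeqExtend.extend s j).top),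
        (CentreSeqExtend.extend s j).comp.base y ∉ R → IsEndNear (K.comap (CentreSeqExtend.extend s j).comp) 𝓛'' y
  | X, U, .nil _, j, _, _, _, Z, R, hZ, hZj, _, K, 𝓛, 𝓛', hend, hs => by
    refine ⟨𝓛 ++ 𝓛'.map (·.map j), fun y hy hyR => ?_⟩
    change y ∈ ((K.comap (𝟙 X)).support : Set X) at hy
    change y ∉ R at hyR
    change IsEndNear (K.comap (𝟙 X)) _ y
    rw [Scheme.IdealSheafData.comap_id] at hy ⊢
    by_cases hyZ : y ∈ Z
    · obtain ⟨u, rfl⟩ := hZj hyZ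
      have hu : u ∈ (((K.comap j).comap (CentreSeq.nil U).comp).support : Set (CentreSeq.nil U).top) := by
        change u ∈ (((K.comap j).comap (𝟙 U)).support : Set U)
        rw [Scheme.IdealSheafData.comap_id]
        exact (mem_support_comap_iff j K u).mpr hy
      have h1 := hs u hu hyZ
      change IsEndNear ((K.comap j).comap (𝟙 U)) 𝓛' u at h1
      rw [Scheme.IdealSheafData.comap_id] at h1
      exact (h1.of_comap_isOpenImmersion j).mono fun F hF => List.mem_append_right _ hF
    · exact (hend y hy hyZ hyR).mono fun F hF => List.mem_append_left _ hF
  | X, U, .cons C rest, j, _, _, _, Z, R, hZ, hZj, hover, K, 𝓛, 𝓛', hend, hs => by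
    obtain ⟨hC, hrest⟩ := hover
    haveI hN' : IsNoetherian (blowup (C.map j)) := isNoetherian_of_isBlowup (blowup.isBlowup _)
    haveI : IsNoetherian (blowup C) := isNoetherian_of_isBlowup (blowup.isBlowup _)
    haveI := CentreSeqExtend.isOpenImmersion_liftOpen C j
    have hCZ : (((C.map j).support : Set X)) ⊆ Z := CentreSeqExtend.support_map_subset C j hZ hC
    -- END of `K·𝒪` on `Bl_{j_* C} X` off `π⁻¹(Z ∪ R)`: `π` is an open immersion off `π⁻¹ V(j_* C) ⊆ π⁻¹ Z`
    set V : (blowup (C.map j)).Opens := blowup.π (C.map j) ⁻¹ᵁ centreCompl (C.map j) with hVdef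
    haveI hφ : IsOpenImmersion (V.ι ≫ blowup.π (C.map j)) := (blowup.isBlowup (C.map j)).isOpenImmersion_preimage_compl_ι
    haveI : CompactSpace (V : Scheme.{u}) :=
      isCompact_iff_compactSpace.mp (TopologicalSpace.NoetherianSpace.isCompact (V : Set (blowup (C.map j))))
    haveI : IsNoetherian (V : Scheme.{u}) := ⟨⟩
    have hend' : ∀ y' ∈ ((K.comap (blowup.π (C.map j))).support : Set (blowup (C.map j))),
        y' ∉ (blowup.π (C.map j)).base ⁻¹' Z → y' ∉ (blowup.π (C.map j)).base ⁻¹' R →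
        IsEndNear (K.comap (blowup.π (C.map j)))
          ((𝓛.map (·.comap (V.ι ≫ blowup.π (C.map j)))).map (·.map V.ι)) y' := by
      intro y' hy' hyZ hyR
      have hyV : y' ∈ V := fun h => hyZ (hCZ h)
      have hx : (blowup.π (C.map j)).base y' ∈ (K.support : Set X) := (mem_support_comap_iff _ K y').mp hy'
      have h0 : IsEndNear K 𝓛 ((V.ι ≫ blowup.π (C.map j)).base ⟨y', hyV⟩) := hend _ hx hyZ hyR
      have h1 := h0.comap_of_isOpenImmersion (V.ι ≫ blowup.π (C.map j))
      rw [Scheme.IdealSheafData.comap_comp] at h1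
      exact h1.of_comap_isOpenImmersion V.ι
    -- the `s`-side data, rewritten for the recursion
    have e : (K.comap j).comap (rest.comp ≫ blowup.π C) =
        ((K.comap (blowup.π (C.map j))).comap (CentreSeqExtend.liftOpen C j)).comap rest.comp := by
      simp only [← Scheme.IdealSheafData.comap_comp, Category.assoc, CentreSeqExtend.liftOpen_π]
    have hs' : ∀ y ∈ ((((K.comap (blowup.π (C.map j))).comap (CentreSeqExtend.liftOpen C j)).comap rest.comp).support : Set rest.top),
        (CentreSeqExtend.liftOpen C j).base (rest.comp.base y) ∈ (blowup.π (C.map j)).base ⁻¹' Z →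
        IsEndNear (((K.comap (blowup.π (C.map j))).comap (CentreSeqExtend.liftOpen C j)).comap rest.comp) 𝓛' y := by
      intro y hy hyZ
      have hyZ' : j.base ((CentreSeq.cons C rest).comp.base y) ∈ Z := by
        change j.base ((rest.comp ≫ blowup.π C).base y) ∈ Z
        rw [Set.mem_preimage, ← Scheme.Hom.comp_apply, CentreSeqExtend.liftOpen_π, Scheme.Hom.comp_apply] at hyZ
        rwa [Scheme.Hom.comp_apply]
      rw [← e]
      exact hs y (by change y ∈ ((((K.comap j).comap (rest.comp ≫ blowup.π C))).support : Set rest.top); rwa [e]) hyZ'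
    obtain ⟨𝓛'', h''⟩ := exists_isEndNear_extend rest (CentreSeqExtend.liftOpen C j)
      (Z := (blowup.π (C.map j)).base ⁻¹' Z) (R := (blowup.π (C.map j)).base ⁻¹' R)
      (hZ.preimage (blowup.π (C.map j)).continuous) (CentreSeqExtend.range_liftOpen_of_mem C j hZj)
      (by rw [CentreSeqExtend.preimage_liftOpen]; exact hrest) (K.comap (blowup.π (C.map j))) _ 𝓛' hend' hs'
    refine ⟨𝓛'', fun y hy hyR => ?_⟩
    change IsEndNear (K.comap ((CentreSeqExtend.extend rest (CentreSeqExtend.liftOpen C j)).comp ≫ blowup.π (C.map j))) 𝓛'' y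
    change y ∈ ((K.comap ((CentreSeqExtend.extend rest (CentreSeqExtend.liftOpen C j)).comp ≫ blowup.π (C.map j))).support :
      Set (CentreSeqExtend.extend rest (CentreSeqExtend.liftOpen C j)).top) at hy
    change ((CentreSeqExtend.extend rest (CentreSeqExtend.liftOpen C j)).comp ≫ blowup.π (C.map j)).base y ∉ R at hyR
    rw [Scheme.IdealSheafData.comap_comp] at hy ⊢
    rw [Scheme.Hom.comp_apply] at hyR
    exact h'' y hy hyR

/-! ## §3 The pieces bridge -/

/-- Two stages make one sequence, for any property of (top, total transform) (recursion on the first stage). [folklore] -/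
theorem centreSeq_exists_two_stage (Q : ∀ (Y : Scheme.{u}), Y.IdealSheafData → Prop) :
    ∀ {X : Scheme.{u}} (c : CentreSeq X) (K : X.IdealSheafData) (T : Set X),
    c.AllRegular → c.CentresOver T → ∀ (s : CentreSeq c.top), s.AllRegular → s.CentresOver (c.comp.base ⁻¹' T) →
      Scheme.IsRegular s.top → Q s.top (K.comap (s.comp ≫ c.comp)) →
      ∃ t : CentreSeq X, t.AllRegular ∧ t.CentresOver T ∧ Scheme.IsRegular t.top ∧ Q t.top (K.comap t.comp)
  | X, .nil _, K, T, _, _, s, hsreg, hsover, hstop, hQ => by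
    refine ⟨s, hsreg, ?_, hstop, ?_⟩
    · have hT : (CentreSeq.nil X).comp.base ⁻¹' T = T := by ext; rfl
      rwa [hT] at hsover
    · change Q s.top (K.comap (s.comp ≫ 𝟙 X)) at hQ
      erw [Category.comp_id] at hQ
      exact hQ
  | X, .cons C rest, K, T, hcreg, hcover, s, hsreg, hsover, hstop, hQ => by
    obtain ⟨hC, hrest⟩ := hcreg
    obtain ⟨hCT, hrestT⟩ := hcover
    have hsover' : s.CentresOver (rest.comp.base ⁻¹' (blowup.π C ⁻¹' T)) := by
      rw [← Set.preimage_comp]; exact hsover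
    have hQ' : Q s.top ((K.comap (blowup.π C)).comap (s.comp ≫ rest.comp)) := by
      change Q s.top (K.comap (s.comp ≫ rest.comp ≫ blowup.π C)) at hQ
      rwa [← Category.assoc, Scheme.IdealSheafData.comap_comp] at hQ
    obtain ⟨t, htreg, htover, httop, htQ⟩ :=
      centreSeq_exists_two_stage Q rest (K.comap (blowup.π C)) (blowup.π C ⁻¹' T) hrest hrestT s hsreg hsover' hstop hQ'
    refine ⟨.cons C t, ⟨hC, htreg⟩, ⟨hCT, htover⟩, httop, ?_⟩
    change Q t.top (K.comap (t.comp ≫ blowup.π C))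
    rwa [Scheme.IdealSheafData.comap_comp]

/-- [OURS · L1 W5.2] **THE PIECES BRIDGE, inductive form** (finitely many indexed pieces, a forbidden closed set `D`). -/
theorem goodEnd_of_closedPieces_aux : ∀ (n : ℕ) {X : Scheme.{u}} [IsNoetherian X] (_ : Scheme.IsRegular X) (K : X.IdealSheafData)
    (𝓛₀ : List X.IdealSheafData) (D : Set X) (_ : IsClosed D) (P : Fin n → Closeds X),
    (∀ i k, i ≠ k → Disjoint (P i : Set X) (P k)) → (∀ i, Disjoint (P i : Set X) D) → (∀ i, (P i : Set X) ⊆ K.support) →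
    (∀ x ∈ (K.support : Set X), (∀ i, x ∉ (P i : Set X)) → IsEndNear K 𝓛₀ x) →
    (∀ i, ∀ (Y : Scheme.{u}) [IsNoetherian Y] (g : Y ⟶ X) [IsOpenImmersion g], (P i : Set X) ⊆ Set.range g.base →
      Disjoint (Set.range g.base) D → (∀ k, k ≠ i → Disjoint (Set.range g.base) (P k)) →
      ∃ s : CentreSeq Y, s.AllRegular ∧ s.CentresOver (g.base ⁻¹' (P i)) ∧ Scheme.IsRegular s.top ∧
        ∃ 𝓛' : List s.top.IdealSheafData, ∀ y ∈ (((K.comap g).comap s.comp).support : Set s.top),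
          g.base (s.comp.base y) ∈ (P i : Set X) → IsEndNear ((K.comap g).comap s.comp) 𝓛' y) →
    ∃ c : CentreSeq X, c.AllRegular ∧ c.CentresOver (K.support : Set X) ∧ Scheme.IsRegular c.top ∧
      ∃ _ : IsNoetherian c.top, GoodEnd (K.comap c.comp)
  | 0, X, _, hX, K, 𝓛₀, D, hD, P, _, _, _, hend, _ => by
    refine ⟨.nil X, trivial, trivial, hX, (inferInstance : IsNoetherian X), 𝓛₀, fun x hx => ?_⟩
    change x ∈ ((K.comap (𝟙 X)).support : Set X) at hx
    change IsEndNear (K.comap (𝟙 X)) 𝓛₀ x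
    rw [Scheme.IdealSheafData.comap_id] at hx ⊢
    exact hend x hx fun i => i.elim0
  | n + 1, X, _, hX, K, 𝓛₀, D, hD, P, hdisj, hPD, hPK, hend, hcure => by
    -- the piece `P 0`, cured on the open `U := X ∖ (D ∪ ⋃_{k ≥ 1} P k)`
    set R : Set X := ⋃ k : Fin n, (P k.succ : Set X) with hRdef
    have hRc : IsClosed R := isClosed_iUnion_of_finite fun k => (P k.succ).isClosed
    set U : X.Opens := ⟨(D ∪ R)ᶜ, (hD.union hRc).isOpen_compl⟩ with hUdef
    haveI : CompactSpace (U : Scheme.{u}) :=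
      isCompact_iff_compactSpace.mp (TopologicalSpace.NoetherianSpace.isCompact (U : Set X))
    haveI : IsNoetherian (U : Scheme.{u}) := ⟨⟩
    have hP0U : (P 0 : Set X) ⊆ Set.range U.ι.base := by
      rw [Scheme.Opens.range_ι]
      intro x hx h
      rcases h with h | h
      · exact Set.disjoint_left.mp (hPD 0) hx h
      · obtain ⟨k, hk⟩ := Set.mem_iUnion.mp h
        exact Set.disjoint_left.mp (hdisj 0 k.succ (Fin.succ_ne_zero k).symm) hx hk
    obtain ⟨s, hsreg, hsover, hstop, 𝓛', hsend⟩ := hcure 0 U U.ι hP0U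
      (by rw [Scheme.Opens.range_ι]; exact Set.disjoint_left.mpr fun x hx hxD => hx (Or.inl hxD))
      (by
        intro k hk
        rw [Scheme.Opens.range_ι]
        refine Set.disjoint_left.mpr fun x hx hxk => hx (Or.inr ?_)
        obtain ⟨k', rfl⟩ := Fin.exists_succ_eq.mpr hk
        exact Set.mem_iUnion.mpr ⟨k', hxk⟩)
    -- extend it to `X`: centres over the closed `P 0`, regular, END off the remaining pieces
    set c₁ := CentreSeqExtend.extend s U.ι with hc₁def
    have hc₁reg : c₁.AllRegular := CentreSeqExtend.allRegular_extend s U.ι (P 0).isClosed hP0U hsover hsreg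
    have hc₁over : c₁.CentresOver (P 0 : Set X) := CentreSeqExtend.centresOver_extend s U.ι (P 0).isClosed hsover
    have hc₁top : Scheme.IsRegular c₁.top := CentreSeqExtend.isRegular_top_of_allRegular _ hX hc₁reg
    haveI hc₁N : IsNoetherian c₁.top := CentreSeq.isNoetherian_top c₁
    obtain ⟨𝓛₁, hend₁⟩ := exists_isEndNear_extend s U.ι (Z := (P 0 : Set X)) (R := R) (P 0).isClosed hP0U hsover K 𝓛₀ 𝓛'
      (fun x hx hx0 hxR => hend x hx fun i => by
        refine Fin.cases hx0 (fun k hk => hxR (Set.mem_iUnion.mpr ⟨k, hk⟩)) i)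
      hsend
    -- the remaining pieces, transported to `c₁.top`
    set P₁ : Fin n → Closeds c₁.top := fun k => ⟨c₁.comp.base ⁻¹' (P k.succ : Set X), (P k.succ).isClosed.preimage c₁.comp.continuous⟩
      with hP₁def
    have hD₁ : IsClosed (c₁.comp.base ⁻¹' (D ∪ (P 0 : Set X))) := (hD.union (P 0).isClosed).preimage c₁.comp.continuous
    obtain ⟨c₂, hc₂reg, hc₂over, hc₂top, hc₂N, hgood⟩ := goodEnd_of_closedPieces_aux n hc₁top (K.comap c₁.comp) 𝓛₁
      (c₁.comp.base ⁻¹' (D ∪ (P 0 : Set X))) hD₁ P₁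
      (fun i k hik => (hdisj i.succ k.succ fun h => hik (Fin.succ_injective _ h)).preimage _)
      (fun i => Set.disjoint_left.mpr fun y hy hyD => by
        rcases hyD with h | h
        · exact Set.disjoint_left.mp (hPD i.succ) hy h
        · exact Set.disjoint_left.mp (hdisj i.succ 0 (Fin.succ_ne_zero i)) hy h)
      (fun i y hy => by rw [Scheme.IdealSheafData.support_comap]; exact hPK i.succ hy)
      (fun y hy hyP => hend₁ y hy fun hyR => by
        obtain ⟨k, hk⟩ := Set.mem_iUnion.mp hyR
        exact hyP k hk)
      (by
        intro i Y _ g₁ _ hPi hgD hgk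
        -- compose with `c₁.comp`: an open immersion into `X` (its range misses `P 0`)
        have hrange : Set.range (g₁ ≫ c₁.comp).base ⊆ (P 0 : Set X)ᶜ := by
          rintro _ ⟨y, rfl⟩ h
          exact Set.disjoint_left.mp hgD ⟨y, rfl⟩ (Or.inr h)
        haveI := centreSeq_isOpenImmersion_comp_of_range_subset c₁ (P 0).isClosed hc₁over g₁ hrange
        obtain ⟨t, htreg, htover, httop, 𝓛t, ht⟩ := hcure i.succ Y (g₁ ≫ c₁.comp)
          (by
            intro x hx
            have hx0 : x ∉ (P 0 : Set X) := fun h => Set.disjoint_left.mp (hdisj i.succ 0 (Fin.succ_ne_zero i)) hx h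
            obtain ⟨y₁, hy₁⟩ := centreSeq_exists_eq_comp_of_not_mem c₁ (P 0).isClosed hc₁over hx0
            obtain ⟨y, hy⟩ := hPi (show y₁ ∈ (P₁ i : Set c₁.top) by change c₁.comp.base y₁ ∈ (P i.succ : Set X); rw [hy₁]; exact hx)
            exact ⟨y, by rw [Scheme.Hom.comp_apply, hy, hy₁]⟩)
          (Set.disjoint_left.mpr fun x ⟨y, hy⟩ hxD => Set.disjoint_left.mp hgD ⟨y, rfl⟩ (Or.inl (by rw [← hy] at hxD; exact hxD)))
          (by
            intro k hk
            refine Set.disjoint_left.mpr ?_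
            rintro _ ⟨y, rfl⟩ hxk
            rcases Fin.eq_zero_or_eq_succ k with rfl | ⟨k', rfl⟩
            · exact Set.disjoint_left.mp hgD ⟨y, rfl⟩ (Or.inr hxk)
            · exact Set.disjoint_left.mp (hgk k' fun h' => hk (by rw [h'])) ⟨y, rfl⟩ hxk)
        refine ⟨t, htreg, ?_, httop, 𝓛t, fun y hy hyP => ?_⟩
        · have : (g₁ ≫ c₁.comp).base ⁻¹' (P i.succ : Set X) = g₁.base ⁻¹' (P₁ i : Set c₁.top) := by
            rw [Scheme.Hom.comp_base, TopCat.coe_comp, Set.preimage_comp]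
            rfl
          rwa [this] at htover
        · rw [Scheme.IdealSheafData.comap_comp] at ht
          exact ht y hy hyP)
    -- one sequence
    obtain ⟨c, hcreg, hcover, hctop, hcQ⟩ := centreSeq_exists_two_stage (fun Y J => ∃ _ : IsNoetherian Y, GoodEnd J) c₁ K
      (K.support : Set X) hc₁reg (hc₁over.mono _ (hPK 0)) c₂ hc₂reg
      (by have h' := hc₂over; rwa [Scheme.IdealSheafData.support_comap] at h') hc₂top
      (by rw [Scheme.IdealSheafData.comap_comp]; exact ⟨hc₂N, hgood⟩)
    exact ⟨c, hcreg, hcover, hctop, hcQ⟩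

/-- [OURS · L1 W5.2 · F7(β) (β-AX) X3 C-I (A′)] **THE PIECES BRIDGE (RULING G12-49 (1), (β′)).**  `X` regular Noetherian, `K` an ideal sheaf,
`𝓛₀` global letters, `P : Fin n → Closeds X` pairwise DISJOINT CLOSED PIECES inside `cosupp K` off which `K` is locally END w.r.t. `𝓛₀`; for
every piece a CURE — on every Noetherian `Y` with an open immersion `g : Y ⟶ X` whose range contains the piece and misses the other pieces, a
blow-up sequence of `Y` with regular centres over the piece, regular top, and local END of the total transform of `g^* K` at the points over
the piece (letters arbitrary).  THEN one blow-up sequence of `X` with regular centres over `cosupp K` and regular Noetherian top makes the total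
transform of `K` locally END at every point of its cosupport: `GoodEnd (K·𝒪)`. [cite: GortzWedhorn2020, Prop. 13.91 (1)–(3)]
[cite: BierstoneGrigorievMilmanWlodarczyk2011, Def. 3.1.5 Remark (1)] -/
theorem goodEnd_of_closedPieces {X : Scheme.{u}} [IsNoetherian X] (hX : Scheme.IsRegular X) (K : X.IdealSheafData)
    (𝓛₀ : List X.IdealSheafData) {n : ℕ} (P : Fin n → Closeds X)
    (hdisj : ∀ i k, i ≠ k → Disjoint (P i : Set X) (P k)) (hPK : ∀ i, (P i : Set X) ⊆ K.support)
    (hend : ∀ x ∈ (K.support : Set X), (∀ i, x ∉ (P i : Set X)) → IsEndNear K 𝓛₀ x)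
    (hcure : ∀ i, ∀ (Y : Scheme.{u}) [IsNoetherian Y] (g : Y ⟶ X) [IsOpenImmersion g], (P i : Set X) ⊆ Set.range g.base →
      (∀ k, k ≠ i → Disjoint (Set.range g.base) (P k)) →
      ∃ s : CentreSeq Y, s.AllRegular ∧ s.CentresOver (g.base ⁻¹' (P i)) ∧ Scheme.IsRegular s.top ∧
        ∃ 𝓛' : List s.top.IdealSheafData, ∀ y ∈ (((K.comap g).comap s.comp).support : Set s.top),
          g.base (s.comp.base y) ∈ (P i : Set X) → IsEndNear ((K.comap g).comap s.comp) 𝓛' y) :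
    ∃ c : CentreSeq X, c.AllRegular ∧ c.CentresOver (K.support : Set X) ∧ Scheme.IsRegular c.top ∧
      ∃ _ : IsNoetherian c.top, GoodEnd (K.comap c.comp) :=
  goodEnd_of_closedPieces_aux n hX K 𝓛₀ ∅ isClosed_empty P hdisj (fun _ => Set.disjoint_empty _) hPK hend
    fun i Y _ g _ hPi _ hgk => hcure i Y g hPi hgk

end Summit.ResolutionOfSingularities.ResolutionOfSingularities.Theorems.X3LemmaM

end
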